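import Summits.ValiantsHypothesis.ValiantsHypothesis.Theorems.DivisionGapPerDivisionHardSparse
import Summits.ValiantsHypothesis.ValiantsHypothesis.Theorems.DivisionGapPerDivisionHardStubTopTransfer
import Summits.ValiantsHypothesis.ValiantsHypothesis.Theorems.DivisionGapPerDivisionHardStubUniqueTopSum
import Summits.ValiantsHypothesis.ValiantsHypothesis.Theorems.DivisionGapPerDivisionHardStubLinearUniqueTop
import Summits.ValiantsHypothesis.ValiantsHypothesis.Theorems.DivisionGapPerDivisionHardStubLocalUniqueTop

/-!
# Crux `DivisionGap.PerDivisionHard` (stmt-ValiantsHypothesis-5065), line `pair-descent-jss-endpoint` —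
the LEX-TOP rungs (skeleton v15, chapter RIGID CELLS, part B)

`PerDivisionHard` asks: for every `c`, for all large `n`, every nonzero `h ∈ ℝ≥0[x_ij]` has
`2^{(log₂ n + c)^c} < L(per_n · h) + L(h)`.  The permanent is homogeneous for EVERY torus character
`w(i,j) = α_i + β_j` (each permutation monomial weighs `Σα + Σβ`), so the initial form `top_w` may
be taken on both sides of the pair at no cost (`stub_topTransfer`): `L(per_n · top_w h) ≤ L(per_n · h)`
and `L(top_w h) ≤ L(h)`.  Consequences proved here, all UNCONDITIONAL:

* `perDivisionHard_topSparse` — if `top_w h` has at most `2^{(log₂ n+c)^c}` monomials for SOME torus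
  character `w`, the crux inequality holds for `h` (transfer + the sparse rung `perDivisionHard_sparse`);
  the torus normal form of `stub_torus` is the special case of the two digit characters.
* `perDivisionHard_uniqueTopSum` — every nonzero `h = Σ_{t∈T} a_t Π_{i∈I t} F_{t,i}` with
  `|T| ≤ 2^{(log₂ n+c)^c}` whose factors are each topped by at most ONE monomial under a common torus
  character (`stub_uniqueTopSum`: then `|supp top_w h| ≤ |T|`).
* `perDivisionHard_sigmaPiSigma` — every nonzero DEPTH-THREE (`ΣΠΣ`) cofactor: sums of at most
  `2^{(log₂ n+c)^c}` products of affine linear forms over `ℝ≥0`, of ANY degree and bottom fan-in (the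
  injective positive character `w(i,j) = i·n + 1 + j` tops a linear form by one variable,
  `stub_linearUniqueTop`).
* `perDivisionHard_localSigmaPi` — every nonzero sum of at most `2^{(log₂ n+c)^c}` products of
  ROW-LOCAL and COLUMN-LOCAL polynomials (each factor lives in the variables of one row or of one
  column; rows and columns mixed freely inside a product; any degrees and densities): the two-scale
  digit character `(D+1)^i + (D+1)^{n+j}` tops each such factor by one monomial
  (`stub_localUniqueTop`).

The last two classes are dense and are separated by no single balanced partition of the variables,
so they lie outside the sparse, atomic and rank rungs of the line.
-/

noncomputable section

-- `Summit.ValiantsHypothesis.ValiantsHypothesis.…` is the tree's mandated single-conjunct layout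
-- (Sub = Summit), so the duplicated namespace component is intended.
set_option linter.dupNamespace false

namespace Summit.ValiantsHypothesis.ValiantsHypothesis.Theorems.DivisionGapPerDivisionHard

open MvPolynomial Literature.Computability.AlgebraicComplexity
open Summit.ValiantsHypothesis.ValiantsHypothesis.Theorems.ZeroOneTransfer.Negative
  (topComponent topComponent_ne_zero)
open scoped NNReal

/-- **The LEX-TOP (top-sparse) rung of `PerDivisionHard`.**  For every `c` there is `n₀` such that
for all `n ≥ n₀`, every torus character `w(i,j) = α_i + β_j` and every nonzero `h ∈ ℝ≥0[x_ij]`: if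
`top_w h` has at most `2^{(log₂ n+c)^c}` monomials then `2^{(log₂ n+c)^c} < L(per_n·h) + L(h)`
(`stub_topTransfer`, then the sparse rung `perDivisionHard_sparse` for `top_w h ≠ 0`). -/
theorem perDivisionHard_topSparse :
    ∀ c : ℕ, ∃ n₀ : ℕ, ∀ n ≥ n₀, ∀ (α β : Fin n → ℕ) (h : MvPolynomial (Fin n × Fin n) ℝ≥0), h ≠ 0 →
      (topComponent (fun e : Fin n × Fin n => α e.1 + β e.2) h).support.card ≤
        2 ^ ((Nat.log 2 n + c) ^ c) →
      2 ^ ((Nat.log 2 n + c) ^ c) < complexity (perPoly (Fin n) ℝ≥0 * h) + complexity h := by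
  intro c
  obtain ⟨n₀, hsp⟩ := perDivisionHard_sparse c
  refine ⟨n₀, fun n hn α β h hh hcard => ?_⟩
  obtain ⟨hle1, hle2⟩ := stub_topTransfer n α β h
  exact lt_of_lt_of_le (hsp n hn _ (topComponent_ne_zero _ hh) hcard) (Nat.add_le_add hle1 hle2)

/-- **The UNIQUELY-TOPPED `ΣΠ` rung of `PerDivisionHard`.**  For every `c` there is `n₀` such that
for all `n ≥ n₀`: a nonzero `h = Σ_{t∈T} a_t Π_{i∈I t} F t i` with `|T| ≤ 2^{(log₂ n+c)^c}` whose
factors are each topped by at most one monomial under a COMMON torus character `α_i + β_j`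
satisfies `2^{(log₂ n+c)^c} < L(per_n·h) + L(h)` — whatever the degrees, densities and number of
the factors (`stub_uniqueTopSum` + `perDivisionHard_topSparse`). -/
theorem perDivisionHard_uniqueTopSum :
    ∀ c : ℕ, ∃ n₀ : ℕ, ∀ n ≥ n₀, ∀ (ι κ : Type) (T : Finset κ) (I : κ → Finset ι)
      (F : κ → ι → MvPolynomial (Fin n × Fin n) ℝ≥0) (a : κ → ℝ≥0) (α β : Fin n → ℕ),
      (∑ t ∈ T, a t • ∏ i ∈ I t, F t i) ≠ 0 → T.card ≤ 2 ^ ((Nat.log 2 n + c) ^ c) →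
      (∀ t ∈ T, ∀ i ∈ I t,
        (topComponent (fun e : Fin n × Fin n => α e.1 + β e.2) (F t i)).support.card ≤ 1) →
      2 ^ ((Nat.log 2 n + c) ^ c) <
        complexity (perPoly (Fin n) ℝ≥0 * ∑ t ∈ T, a t • ∏ i ∈ I t, F t i) +
          complexity (∑ t ∈ T, a t • ∏ i ∈ I t, F t i) := by
  intro c
  obtain ⟨n₀, htop⟩ := perDivisionHard_topSparse c
  refine ⟨n₀, fun n hn ι κ T I F a α β hne hT huniq => ?_⟩
  exact htop n hn α β _ hne (le_trans (stub_uniqueTopSum n ι κ T I F a _ huniq) hT)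

/-- **The `ΣΠΣ` rung of `PerDivisionHard` (depth-three cofactors never help).**  For every `c`
there is `n₀` such that for all `n ≥ n₀`: every nonzero `h = Σ_{t∈T} a_t Π_{i∈I t} ℓ_{t,i}` with
affine linear forms `ℓ_{t,i}` over `ℝ≥0` (`totalDegree ≤ 1`), top fan-in `|T| ≤ 2^{(log₂ n+c)^c}`,
ANY degree and bottom fan-in, satisfies `2^{(log₂ n+c)^c} < L(per_n·h) + L(h)`
(`stub_linearUniqueTop` under the character `w(i,j) = i·n + 1 + j` + `perDivisionHard_uniqueTopSum`). -/
theorem perDivisionHard_sigmaPiSigma :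
    ∀ c : ℕ, ∃ n₀ : ℕ, ∀ n ≥ n₀, ∀ (ι κ : Type) (T : Finset κ) (I : κ → Finset ι)
      (F : κ → ι → MvPolynomial (Fin n × Fin n) ℝ≥0) (a : κ → ℝ≥0),
      (∑ t ∈ T, a t • ∏ i ∈ I t, F t i) ≠ 0 → T.card ≤ 2 ^ ((Nat.log 2 n + c) ^ c) →
      (∀ t ∈ T, ∀ i ∈ I t, (F t i).totalDegree ≤ 1) →
      2 ^ ((Nat.log 2 n + c) ^ c) <
        complexity (perPoly (Fin n) ℝ≥0 * ∑ t ∈ T, a t • ∏ i ∈ I t, F t i) +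
          complexity (∑ t ∈ T, a t • ∏ i ∈ I t, F t i) := by
  intro c
  obtain ⟨n₀, hU⟩ := perDivisionHard_uniqueTopSum c
  refine ⟨n₀, fun n hn ι κ T I F a hne hT hlin => ?_⟩
  exact hU n hn ι κ T I F a (fun i => (i : ℕ) * n + 1) (fun j => (j : ℕ)) hne hT
    fun t ht i hi => stub_linearUniqueTop n (F t i) (hlin t ht i hi)

/-- **The LOCAL `ΣΠ` rung of `PerDivisionHard` (sums of products of row-local and column-local
polynomials never help).**  For every `c` there is `n₀` such that for all `n ≥ n₀`: every nonzero
`h = Σ_{t∈T} a_t Π_{i∈I t} F_{t,i}` with `|T| ≤ 2^{(log₂ n+c)^c}` in which EVERY factor is a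
polynomial in the variables of a single row or of a single column (rows and columns mixed freely
inside one product; any degrees, any densities) satisfies `2^{(log₂ n+c)^c} < L(per_n·h) + L(h)`
(`stub_localUniqueTop` under the two-scale digit character for a common degree bound `D` +
`perDivisionHard_uniqueTopSum`). -/
theorem perDivisionHard_localSigmaPi :
    ∀ c : ℕ, ∃ n₀ : ℕ, ∀ n ≥ n₀, ∀ (ι κ : Type) (T : Finset κ) (I : κ → Finset ι)
      (F : κ → ι → MvPolynomial (Fin n × Fin n) ℝ≥0) (a : κ → ℝ≥0),
      (∑ t ∈ T, a t • ∏ i ∈ I t, F t i) ≠ 0 → T.card ≤ 2 ^ ((Nat.log 2 n + c) ^ c) →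
      (∀ t ∈ T, ∀ i ∈ I t,
        (∃ r : Fin n, ∀ mm ∈ (F t i).support, ∀ e ∈ mm.support, e.1 = r) ∨
          (∃ s : Fin n, ∀ mm ∈ (F t i).support, ∀ e ∈ mm.support, e.2 = s)) →
      2 ^ ((Nat.log 2 n + c) ^ c) <
        complexity (perPoly (Fin n) ℝ≥0 * ∑ t ∈ T, a t • ∏ i ∈ I t, F t i) +
          complexity (∑ t ∈ T, a t • ∏ i ∈ I t, F t i) := by
  intro c
  obtain ⟨n₀, hU⟩ := perDivisionHard_uniqueTopSum c
  refine ⟨n₀, fun n hn ι κ T I F a hne hT hloc => ?_⟩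
  -- a common degree bound for the finitely many factors
  set D : ℕ := T.sup fun t => (I t).sup fun i => (F t i).totalDegree with hD
  refine hU n hn ι κ T I F a (fun i => (D + 1) ^ (i : ℕ)) (fun j => (D + 1) ^ (n + (j : ℕ))) hne hT
    fun t ht i hi => stub_localUniqueTop n D (F t i) ?_ (hloc t ht i hi)
  exact le_trans (Finset.le_sup (f := fun i => (F t i).totalDegree) hi)
    (Finset.le_sup (f := fun t => (I t).sup fun i => (F t i).totalDegree) ht)

end Summit.ValiantsHypothesis.ValiantsHypothesis.Theorems.DivisionGapPerDivisionHard

end
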